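import Summits.Ventures.PercRepro.Night2LocalD3ThreeOneA
import Summits.Ventures.PercRepro.Night2LocalD3KTwo

/-!
# PercRepro — the cell `(a, k) = (3, 1)` at `|E ∖ G| = 3`, `q = 4`: **`load2_le_cap2_three_one`** (night-2, gen 13)

At a far set `S` with three coloops `{y, x₁, x₂}` (`y` the coloop of `M|G`) and non-coloops `T = {w₁, w₂, w₃}` (a line), with
`r' = req(S ∖ x₁) + req(S ∖ x₂) ≤ 12/25`, `rᵢ = [cand wᵢ member] · req(cand wᵢ)`, `aᵢ = [cand wᵢ ∈ ex2] · rᵢ/(|G ∖ cl(cand wᵢ)| − 1)`,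
`Lᵢ = r' + Σ_{j ≠ i} rⱼ ≥ L₁(S ∖ wᵢ)` and the loss fraction `λ(L) = (L − 7/10)⁺/L` (the capacity left by layer 0 is `≥ 7/10`):

* `load₂(S) ≤ Σᵢ aᵢ (λ(Lⱼ) + λ(Lₖ))` and `cap₂(S) ≥ 7/10 − ([S ∖ x₁ member] req(S ∖ x₁) + [S ∖ x₂ member] req(S ∖ x₂))`;
* two fat candidates (`G ∖ S ⊆ cl(cand w)`) kill both preimages of `S`, so `cap₂ ≥ 7/10 ≥ 3 · 2 · (6/25)(13/48)`;
* otherwise at most one candidate is fat (`rᵢ ≤ 6/25`, `aᵢ ≤ 6/25`), the others thin (`rᵢ ≤ 1/5`, `aᵢ ≤ 1/10`): the evaluation at the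
  type bounds (`cand_arith_gen`) is `≤ 0.2035 ≤ 0.22 = 7/10 − 12/25` (one fat) resp. `≤ 0.1227` (none).
-/

open scoped Matroid

namespace PercRepro.Shadow

open Finset PerFlat ThmH

variable {α : Type*} [DecidableEq α] {M : Matroid α} [M.Finite]

/-! ## The generic loss fraction `(L − c)⁺ / L` -/

omit [DecidableEq α] [M.Finite] in
/-- `(L − c)⁺ / L ≥ 0` for `c > 0`. -/
theorem lossFracC_nonneg {c : ℚ} (hc : 0 < c) (L : ℚ) : 0 ≤ (if L ≤ c then (0 : ℚ) else (L - c) / L) := by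
  split_ifs with h
  · exact le_refl _
  · push Not at h
    exact div_nonneg (by linarith) (by linarith)

omit [DecidableEq α] [M.Finite] in
/-- `(L − c)⁺ / L` is monotone in `L` for `c > 0`. -/
theorem lossFracC_mono {c : ℚ} (hc : 0 < c) {L L' : ℚ} (h : L ≤ L') :
    (if L ≤ c then (0 : ℚ) else (L - c) / L) ≤ (if L' ≤ c then (0 : ℚ) else (L' - c) / L') := by
  split_ifs with h1 h2 h2
  · exact le_refl _
  · push Not at h2
    exact div_nonneg (by linarith) (by linarith)
  · push Not at h1
    linarith
  · push Not at h1 h2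
    have hL : 0 < L := by linarith
    have hL' : 0 < L' := by linarith
    rw [sub_div, sub_div, div_self hL.ne', div_self hL'.ne']
    have : c / L' ≤ c / L := div_le_div_of_nonneg_left hc.le hL h
    linarith

section ThreeOneB

variable {G S : Finset α}

/-- The generic loss bound: `loss ≤ req · (L − c)⁺/L` once `L₁(B ∪ {z}) ≤ L` and `c ≤ capS(B ∪ {z})`, `c > 0`. -/
theorem loss_le_req_mul_lossFracC {c : ℚ} (hc : 0 < c) {B : Finset α} {z : α} {L : ℚ}
    (hL : L1 M 4 G (insert z B) ≤ L) (hcap : c ≤ capS M 4 G (insert z B)) :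
    loss M 4 G B z ≤ req M 4 B * (if L ≤ c then (0 : ℚ) else (L - c) / L) := by
  split_ifs with hle
  · unfold loss fS
    rw [if_pos (hL.trans (hle.trans hcap))]
    simp
  · push Not at hle
    exact loss_le_of_L1_le hL hcap hc hle.le

/-- With one coloop of `M|G` the capacity left by layer 0 is at least `7/10` at every subset of `G`. -/
theorem seven_tenths_le_capS (hd : (gr M \ G).card = 3) (hk : kColoops M G = 1) {S' : Finset α} (hS' : S' ⊆ G) :
    7 / 10 ≤ capS M 4 G S' := by
  have hk1 : k1 M 4 G S' ≤ 1 := hk ▸ k1_le_kColoops hS'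
  have hcapS : capS M 4 G S' = 1 - (k1 M 4 G S' : ℚ) * (3 / 10) := by
    unfold capS; rw [hd]; unfold phiQ; push_cast; ring
  rw [hcapS]
  have : (k1 M 4 G S' : ℚ) ≤ 1 := by exact_mod_cast hk1
  linarith

open scoped Classical in
/-- **The layer-2 weight of a candidate at one coloop of `M|G`**: with `T = {w, u, u'}`,
`w₂(cand w, S) ≤ req(cand w)/(|G ∖ cl(cand w)| − 1) · (λ(L_u) + λ(L_{u'}))`, `λ(L) = (L − 7/10)⁺/L`, for bounds
`L₁(S ∖ u) ≤ L_u`, `L₁(S ∖ u') ≤ L_{u'}`. -/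
theorem w2_cand_le_one (hd : (gr M \ G).card = 3) (hk : kColoops M G = 1)
    (hS : S ∈ shadowAt M (4 + 2) 4 (Uq M (4 + 2) 4) G) {w u u' : α} (hT : nonColoops M S = {w, u, u'})
    (hwu : w ≠ u) (hwu' : w ≠ u') (huu' : u ≠ u') (hB : insert w (coloops M S) ∈ ex2 M 4 G S) {Lu Lu' : ℚ}
    (hLu : L1 M 4 G (S.erase u) ≤ Lu) (hLu' : L1 M 4 G (S.erase u') ≤ Lu') :
    w2 M 4 G (insert w (coloops M S)) S ≤
      req M 4 (insert w (coloops M S)) / (((G \ clF M (insert w (coloops M S))).card : ℚ) - 1) *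
        ((if Lu ≤ 7 / 10 then (0 : ℚ) else (Lu - 7 / 10) / Lu) + (if Lu' ≤ 7 / 10 then (0 : ℚ) else (Lu' - 7 / 10) / Lu')) := by
  have hSG : S ⊆ G := subset_of_mem_shadowAt hS
  obtain ⟨-, hB0, hBS, hsub, hcard⟩ := mem_ex2_unpack hB
  set B := insert w (coloops M S) with hBdef
  have hu : u ∈ nonColoops M S := by rw [hT]; exact Finset.mem_insert_of_mem (Finset.mem_insert_self _ _)
  have hu' : u' ∈ nonColoops M S := by
    rw [hT]; exact Finset.mem_insert_of_mem (Finset.mem_insert_of_mem (Finset.mem_singleton_self _))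
  have hSB : S \ B = {u, u'} := by
    ext e
    rw [Finset.mem_sdiff, hBdef, Finset.mem_insert, Finset.mem_insert, Finset.mem_singleton]
    constructor
    · rintro ⟨heS, hnot⟩
      rw [not_or] at hnot
      have : e ∈ nonColoops M S := mem_nonColoops.2 ⟨heS, hnot.2⟩
      rw [hT, Finset.mem_insert, Finset.mem_insert, Finset.mem_singleton] at this
      rcases this with rfl | rfl | rfl
      · exact absurd rfl hnot.1
      · exact Or.inl rfl
      · exact Or.inr rfl
    · rintro (rfl | rfl)
      · exact ⟨(mem_nonColoops.1 hu).1, by rintro (h | h); exact hwu h.symm; exact (mem_nonColoops.1 hu).2 h⟩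
      · exact ⟨(mem_nonColoops.1 hu').1, by rintro (h | h); exact hwu' h.symm; exact (mem_nonColoops.1 hu').2 h⟩
  have hcov1 : insert u B = S.erase u' := by
    have hT' : nonColoops M S = {u', u, w} := by
      rw [hT, Finset.pair_comm u u', Finset.insert_comm w u', Finset.pair_comm w u]
    rw [hBdef, ← erase_erase_eq_insert hT' huu'.symm hwu'.symm hwu.symm]
    rw [Finset.insert_erase]
    rw [Finset.mem_erase]
    exact ⟨huu', (mem_nonColoops.1 hu).1⟩
  have hcov2 : insert u' B = S.erase u := by
    have hT' : nonColoops M S = {u, u', w} := by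
      rw [hT, Finset.insert_comm w u, Finset.pair_comm w u']
    rw [hBdef, ← erase_erase_eq_insert hT' huu' hwu.symm hwu'.symm]
    rw [Finset.insert_erase]
    rw [Finset.mem_erase]
    exact ⟨huu'.symm, (mem_nonColoops.1 hu').1⟩
  have hl1 : loss M 4 G B u ≤ req M 4 B * (if Lu' ≤ 7 / 10 then (0 : ℚ) else (Lu' - 7 / 10) / Lu') := by
    apply loss_le_req_mul_lossFracC (by norm_num)
    · rw [hcov1]; exact hLu'
    · rw [hcov1]; exact seven_tenths_le_capS hd hk ((Finset.erase_subset _ _).trans hSG)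
  have hl2 : loss M 4 G B u' ≤ req M 4 B * (if Lu ≤ 7 / 10 then (0 : ℚ) else (Lu - 7 / 10) / Lu) := by
    apply loss_le_req_mul_lossFracC (by norm_num)
    · rw [hcov2]; exact hLu
    · rw [hcov2]; exact seven_tenths_le_capS hd hk ((Finset.erase_subset _ _).trans hSG)
  have hm : 2 ≤ (G \ clF M B).card := hcard ▸ Finset.card_le_card hsub
  have hden : (1 : ℚ) ≤ ((G \ clF M B).card : ℚ) - 1 := by
    have : (2 : ℚ) ≤ ((G \ clF M B).card : ℚ) := by exact_mod_cast hm
    linarith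
  unfold w2
  rw [if_pos ⟨hB0, hBS, hsub, hcard⟩, hSB, Finset.sum_pair huu', div_mul_eq_mul_div]
  apply div_le_div_of_nonneg_right _ (by linarith)
  rw [mul_add]
  linarith

omit [DecidableEq α] [M.Finite] in
/-- **The generic core bound** with capacity `c` and preimage mass `ρ ≤ ρ̂`. -/
theorem cand_arith_gen (lam : ℚ → ℚ) (hlam0 : ∀ L, 0 ≤ lam L) (hlam : ∀ {L L' : ℚ}, L ≤ L' → lam L ≤ lam L')
    (c ρ ρ' r' r₁ r₂ r₃ a₁ a₂ a₃ L₁ L₂ L₃ c' c₁ c₂ c₃ b₁ b₂ b₃ : ℚ)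
    (ha10 : 0 ≤ a₁) (ha20 : 0 ≤ a₂) (ha30 : 0 ≤ a₃) (hρ : ρ ≤ ρ')
    (hL1 : L₁ ≤ r' + r₂ + r₃) (hL2 : L₂ ≤ r' + r₁ + r₃) (hL3 : L₃ ≤ r' + r₁ + r₂)
    (hc' : r' ≤ c') (hc1 : r₁ ≤ c₁) (hc2 : r₂ ≤ c₂) (hc3 : r₃ ≤ c₃) (hb1 : a₁ ≤ b₁) (hb2 : a₂ ≤ b₂) (hb3 : a₃ ≤ b₃)
    (hfin : b₁ * lam (c' + c₁ + c₃) + b₁ * lam (c' + c₁ + c₂) + b₂ * lam (c' + c₂ + c₃) + b₂ * lam (c' + c₁ + c₂) +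
      b₃ * lam (c' + c₂ + c₃) + b₃ * lam (c' + c₁ + c₃) ≤ c - ρ') :
    a₁ * (lam L₂ + lam L₃) + a₂ * (lam L₁ + lam L₃) + a₃ * (lam L₁ + lam L₂) ≤ c - ρ := by
  have l1 : lam L₁ ≤ lam (c' + c₂ + c₃) := hlam (by linarith)
  have l2 : lam L₂ ≤ lam (c' + c₁ + c₃) := hlam (by linarith)
  have l3 : lam L₃ ≤ lam (c' + c₁ + c₂) := hlam (by linarith)
  have p12 : a₁ * lam L₂ ≤ b₁ * lam (c' + c₁ + c₃) := mul_le_mul hb1 l2 (hlam0 _) (by linarith)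
  have p13 : a₁ * lam L₃ ≤ b₁ * lam (c' + c₁ + c₂) := mul_le_mul hb1 l3 (hlam0 _) (by linarith)
  have p21 : a₂ * lam L₁ ≤ b₂ * lam (c' + c₂ + c₃) := mul_le_mul hb2 l1 (hlam0 _) (by linarith)
  have p23 : a₂ * lam L₃ ≤ b₂ * lam (c' + c₁ + c₂) := mul_le_mul hb2 l3 (hlam0 _) (by linarith)
  have p31 : a₃ * lam L₁ ≤ b₃ * lam (c' + c₂ + c₃) := mul_le_mul hb3 l1 (hlam0 _) (by linarith)
  have p32 : a₃ * lam L₂ ≤ b₃ * lam (c' + c₁ + c₃) := mul_le_mul hb3 l2 (hlam0 _) (by linarith)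
  have hexp : a₁ * (lam L₂ + lam L₃) + a₂ * (lam L₁ + lam L₃) + a₃ * (lam L₁ + lam L₂) =
      a₁ * lam L₂ + a₁ * lam L₃ + a₂ * lam L₁ + a₂ * lam L₃ + a₃ * lam L₁ + a₃ * lam L₂ := by ring
  rw [hexp]
  linarith

/-- A candidate has `|G ∖ cl(cand w)| ≥ 2` (`T ∖ w` lies outside the closure). -/
theorem two_le_card_sdiff_clF_cand (hG : G ∈ flatsQ M (4 + 1)) (hS : S ∈ shadowAt M (4 + 2) 4 (Uq M (4 + 2) 4) G)
    (hS6 : S.card = 6) (hT : (nonColoops M S).card = 3) {w : α} (hw : w ∈ nonColoops M S) :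
    2 ≤ (G \ clF M (insert w (coloops M S))).card := by
  have hSG : S ⊆ G := subset_of_mem_shadowAt hS
  have hsub : (nonColoops M S).erase w ⊆ G \ clF M (insert w (coloops M S)) := by
    intro e he
    rw [Finset.mem_erase] at he
    exact Finset.mem_sdiff.2 ⟨hSG (mem_nonColoops.1 he.2).1, not_mem_clF_cand_of_ne hG hS hS6 hT hw he.2 (Ne.symm he.1)⟩
  have := Finset.card_le_card hsub
  rw [Finset.card_erase_of_mem hw, hT] at this
  exact this

open scoped Classical in
/-- **Type bounds of a candidate**: always `r ≤ 6/25`, `a ≤ 6/25`; when `|G ∖ cl(cand w)| ≥ 3`, `r ≤ 1/5`, `a ≤ 1/10`. -/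
theorem cand_types (hG : G ∈ flatsQ M (4 + 1)) (hd : (gr M \ G).card = 3)
    (hS : S ∈ shadowAt M (4 + 2) 4 (Uq M (4 + 2) 4) G) (hS6 : S.card = 6) (hT : (nonColoops M S).card = 3) {w : α}
    (hw : w ∈ nonColoops M S) :
    ((if insert w (coloops M S) ∈ membersIn M (Uq M (4 + 2) 4) G then req M 4 (insert w (coloops M S)) else 0) ≤ 6 / 25 ∧
    (if insert w (coloops M S) ∈ ex2 M 4 G S then
      req M 4 (insert w (coloops M S)) / (((G \ clF M (insert w (coloops M S))).card : ℚ) - 1) else 0) ≤ 6 / 25) ∧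
    (3 ≤ (G \ clF M (insert w (coloops M S))).card →
      (if insert w (coloops M S) ∈ membersIn M (Uq M (4 + 2) 4) G then req M 4 (insert w (coloops M S)) else 0) ≤ 1 / 5 ∧
      (if insert w (coloops M S) ∈ ex2 M 4 G S then
        req M 4 (insert w (coloops M S)) / (((G \ clF M (insert w (coloops M S))).card : ℚ) - 1) else 0) ≤ 1 / 10) := by
  have hm2 := two_le_card_sdiff_clF_cand hG hS hS6 hT hw
  have hreq2 : insert w (coloops M S) ∈ membersIn M (Uq M (4 + 2) 4) G → req M 4 (insert w (coloops M S)) ≤ 6 / 25 := by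
    intro hm
    have := req_le_of_le_card hG hd (mem_membersIn.1 hm).2 hm2
    norm_num at this
    exact this
  refine ⟨⟨?_, ?_⟩, ?_⟩
  · split_ifs with h
    · exact hreq2 h
    · norm_num
  · split_ifs with h
    · have hm := (mem_ex2_unpack h).1
      have hden : (1 : ℚ) ≤ ((G \ clF M (insert w (coloops M S))).card : ℚ) - 1 := by
        have : (2 : ℚ) ≤ ((G \ clF M (insert w (coloops M S))).card : ℚ) := by exact_mod_cast hm2
        linarith
      calc req M 4 (insert w (coloops M S)) / (((G \ clF M (insert w (coloops M S))).card : ℚ) - 1)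
          ≤ (6 / 25) / 1 := div_le_div₀ (by norm_num) (hreq2 hm) (by norm_num) hden
        _ = 6 / 25 := by norm_num
    · norm_num
  · intro hm3
    have hreq3 : insert w (coloops M S) ∈ membersIn M (Uq M (4 + 2) 4) G → req M 4 (insert w (coloops M S)) ≤ 1 / 5 := by
      intro hm
      have := req_le_of_le_card hG hd (mem_membersIn.1 hm).2 hm3
      norm_num at this
      exact this
    constructor
    · split_ifs with h
      · exact hreq3 h
      · norm_num
    · split_ifs with h
      · have hm := (mem_ex2_unpack h).1
        have hden : (2 : ℚ) ≤ ((G \ clF M (insert w (coloops M S))).card : ℚ) - 1 := by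
          have : (3 : ℚ) ≤ ((G \ clF M (insert w (coloops M S))).card : ℚ) := by exact_mod_cast hm3
          linarith
        calc req M 4 (insert w (coloops M S)) / (((G \ clF M (insert w (coloops M S))).card : ℚ) - 1)
            ≤ (1 / 5) / 2 := div_le_div₀ (by norm_num) (hreq3 hm) (by norm_num) hden
          _ = 1 / 10 := by norm_num
      · norm_num

/-- A candidate that is not fat (`¬ G ∖ S ⊆ cl(cand w)`) has `|G ∖ cl(cand w)| ≥ 3`. -/
theorem three_le_card_sdiff_clF_cand_of_not_fat (hG : G ∈ flatsQ M (4 + 1))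
    (hS : S ∈ shadowAt M (4 + 2) 4 (Uq M (4 + 2) 4) G) (hS6 : S.card = 6) (hT : (nonColoops M S).card = 3) {w : α}
    (hw : w ∈ nonColoops M S) (hnot : ¬ (G \ S ⊆ clF M (insert w (coloops M S)))) :
    3 ≤ (G \ clF M (insert w (coloops M S))).card := by
  have hSG : S ⊆ G := subset_of_mem_shadowAt hS
  rw [Finset.not_subset] at hnot
  obtain ⟨p, hpP, hpcl⟩ := hnot
  rw [Finset.mem_sdiff] at hpP
  have hsub : insert p ((nonColoops M S).erase w) ⊆ G \ clF M (insert w (coloops M S)) := by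
    intro e he
    rw [Finset.mem_insert] at he
    rw [Finset.mem_sdiff]
    rcases he with rfl | he
    · exact ⟨hpP.1, hpcl⟩
    · rw [Finset.mem_erase] at he
      exact ⟨hSG (mem_nonColoops.1 he.2).1, not_mem_clF_cand_of_ne hG hS hS6 hT hw he.2 (Ne.symm he.1)⟩
  refine le_trans ?_ (Finset.card_le_card hsub)
  rw [Finset.card_insert_of_notMem, Finset.card_erase_of_mem hw, hT]
  intro hp
  exact hpP.2 (mem_nonColoops.1 (Finset.mem_erase.1 hp).2).1

end ThreeOneB

end PercRepro.Shadow
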